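import Summits.BirchSwinnertonDyer.BirchSwinnertonDyer.Theorems.InertBadSignedBranchesInertBadAtThreeIstarZeroOddSupply
import Summits.BirchSwinnertonDyer.BirchSwinnertonDyer.Theorems.InertBadSignedBranchesInertBadAtThreeIstarZeroOddPair
import HarnessLib

/-!
# Route `InertBadSignedBranches` (rung K8), residual crux `InertBadAtThree` — file 3/4: the CLASS NODES
# `LowerHalfOnType p I₀*` at ANY ODD prime and at `p = 3` (seat bsd-cm-inert g10; nothing asserted)

The landed O10-PS chain (`X12/ClassClosureO10Readings.lean`, p402929; x1b's
`Additive/QuadraticBranchLowerHalfOfReadings.lean`) carries `hp5 : 5 ≤ p` for exactly three reasons: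
(i) `p ≠ 2`; (ii) `ord_p c_p(W) = 0` by Kodaira–Néron (`c_p ≤ 4 < p`); (iii) the typed law
`Additive.QuadraticBranchMinusLeadingValuationAt W p 0` (C-cc-1) has `5 ≤ p →` inside its body, so it
can only be USED at `p ≥ 5`. At `p = 3` on the inert-bad CM locus (ii) holds for a different reason —
`3 ∤ Tam(W)` for every CM curve with `3` unramified in the CM field
(`X12.not_three_dvd_tamagawaProduct_of_hasCM_of_not_cmRamified_three`) — and (iii) is the planner's
to restate (a guard-free twin of the law; cell bsd-cm ruling D70 after the referee's PASS on memo N21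
v1.2, which removed the paper obstruction (GZ_η)@3 at `e = p − 1`).

THIS FILE (3/4): `lowerHalfOnType_IstarZero_of_pairLaw_of_lowerReading_of_ne_two` — the O10-PS class
node at any odd `p`: `LowerHalfOnType p I₀*` ⟸ the law in PAIR FORM on the type (the body of C-cc-1
without its `5 ≤ p` guard, as a hypothesis) ∧ (C1_η) on the CM good-inert twins ∧ named facts ∧ the
lower Kobayashi-7.4 reading ∧ `hper` ∧ `ord_p c_p = 0` on the type — and its `p = 3` instance
`lowerHalfOnType_IstarZero_three_of_pairLaw_of_lowerReading` with the Tamagawa hypothesis DISCHARGED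
(file 2/4 §0) and the parity data read at `p* = −3`.

HONEST STATUS (all four files). Everything is CONDITIONAL on displayed hypotheses: the law (C-cc-1) in
pair form, (C1_η), the reading `h74l` and the period datum `hper` are hypotheses, NOT claimed; the two
residual cruxes of the route stay open; nothing is booked; no label moves. With the three files the
`I₀*`-at-3 half of `InertBadAtThree` reads "kernel modulo C-cc-1@3 ∧ (C1_η)@3 ∧ named facts ∧ one
reading ∧ `hper`", exactly like the `p ≥ 5` node of record (`X12/ClassClosureO10Readings.lean`,
p402929); the `III/III*`-at-3 half is untouched (CONSTRUCTION).
[cite: Kobayashi2003, §4 (p. 8), Thm. 7.4 (p. 13), Thm. 3.2 (p. 7)] [cite: Miller2011LMS, Def. 1.1]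
[cite: SilvermanATAEC1994, IV.9.4 and Table 4.1]
-/

set_option autoImplicit false
set_option linter.dupNamespace false

noncomputable section

open scoped Classical MatrixGroups ModularForm NumberField

open CongruenceSubgroup Field Function NumberField IsDedekindDomain IsDedekindDomain.HeightOneSpectrum
  WeierstrassCurve Rat.HeightOneSpectrum
open Literature.NumberTheory.EllipticCurves
open Literature.NumberTheory.EllipticCurves.ModularForms
open Literature.NumberTheory.EllipticCurves.Kobayashi2003
open Literature.NumberTheory.EllipticCurves.Rank1Residual
open Literature.NumberTheory.EllipticCurves.Rank1Residual.Typed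
open Literature.NumberTheory.GaloisRepresentations
open Literature.NumberTheory.GaloisCohomology
open Literature.NumberTheory.EllipticCurves.IwasawaAlgebra
open Summit.BirchSwinnertonDyer.Rank1Residual.Additive
open Summit.BirchSwinnertonDyer.Rank1Residual.Additive.LevelBridge
open Summit.BirchSwinnertonDyer.Rank1Residual
open Summit.BirchSwinnertonDyer.Rank1Residual.X12
open Summit.BirchSwinnertonDyer.Rank1Residual.X12.O10

namespace Summit.BirchSwinnertonDyer.BirchSwinnertonDyer.Theorems.InertBadOdd

variable (W : WeierstrassCurve ℚ) [W.IsElliptic] (p : ℕ) [hp : Fact p.Prime]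

variable {p}

/-! ## §3 Class level at an odd prime: `LowerHalfOnType p I₀*`; the `p = 3` instance -/

/-- **THE O10-PS CLASS NODE AT ANY ODD `p`: `LowerHalfOnType p I₀*`** ⟸ the law in PAIR FORM on every
rank-one CM curve of signed type `(p, I₀*)` (`hlaw` — the body of C-cc-1 /
`QuadraticBranchMinusLeadingValuationAt W p 0` WITHOUT its `5 ≤ p` guard, as a hypothesis; the planner
types the guard-free statement, D70) ∧ (C1_η) on the CM good-inert curves (`hC1`) ∧ the named facts
`hmod hGZ hGZK hPT hnf` ∧ the LOWER Kobayashi-7.4 reading on the type (`h74l`) ∧ the displayed period datum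
`hper` ∧ `ord_p c_p(W) = 0` on the type (`hcp`; at `p ≥ 5` Kodaira–Néron, at `p = 3` the CM Tamagawa
lemma — next theorem). Same shape as the node of record
`X12.O10.lowerHalfOnType_IstarZero_of_valuation_of_lowerReading` (p402929). CONDITIONAL on every
displayed hypothesis; nothing booked; O10 stays OPEN at class level.
[cite: Kobayashi2003, §4 (p. 8), Thm. 7.4 (p. 13), Thm. 3.2 (p. 7)] [cite: Miller2011LMS, Def. 1.1] -/
theorem lowerHalfOnType_IstarZero_of_pairLaw_of_lowerReading_of_ne_two
    (hmod : hasEntireLFunction_rat) (hGZ : GrossZagier1986_thm_I_7_3)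
    (hGZK : rank_eq_analyticRank_of_analyticRank_le_one)
    (hPT : poitouTate_selmerStructure_duality_real ℚ) (hnf : exists_isNewformOf)
    (hper : ∀ (V : WeierstrassCurve ℚ) [V.IsElliptic] [V.IsGloballyMinimal]
      {N : ℕ} [NeZero N] (f : CuspForm (Gamma0 N) 2), IsNewformOf V f →
      V.HasGoodReductionAtPrime p → V.frobeniusTrace p = 0 →
      ∃ ϖ : ℚ, ‖(ϖ : ℚ_[p])‖ ≤ 1 ∧
        (if Even (p / 2) then (ϖ : ℝ) * V.realPeriodRat = plusPeriod f
          else (ϖ : ℝ) * V.imaginaryPeriodRat = minusPeriod f))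
    (hlaw : ∀ (W : WeierstrassCurve ℚ) [W.IsElliptic] [W.IsGloballyMinimal],
      HasSignedLocalType W p (.Istar 0) → W.analyticRank = 1 →
      ∀ (V : WeierstrassCurve ℚ) [V.IsElliptic] [V.IsGloballyMinimal] (C : VariableChange ℚ)
        {N : ℕ} [NeZero N] {f : CuspForm (Gamma0 N) 2},
        C • W.quadraticTwist ((-1) ^ (p / 2) * p) = V →
        V.HasGoodReductionAtPrime p → V.frobeniusTrace p = 0 → IsNewformOf V f →
        ∀ (ϖ : ℚ), (if Even (p / 2) then (ϖ : ℝ) * V.realPeriodRat = plusPeriod f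
            else (ϖ : ℝ) * V.imaginaryPeriodRat = minusPeriod f) →
        ∀ (L : IwasawaAlgebra p), IsQuadraticBranchMinusLFunction f p ϖ L →
        (∀ Q : (W.baseChange ℚ_[p]).toAffine.Point, p • Q = 0 → Q = 0) →
        ∀ (P : W.toAffine.Point) (n : ℕ), ¬ IsOfFinAddOrder P →
        (∀ R : W.toAffine.Point, ∃ (k : ℤ) (T : W.toAffine.Point), IsOfFinAddOrder T ∧ R = k • P + T) →
        (∃ Q : (W.baseChange ℚ_[p]).toAffine.Point, p ^ n • Q = W.toPadicPoint p P) →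
        (∀ Q : (W.baseChange ℚ_[p]).toAffine.Point, p ^ (n + 1) • Q ≠ W.toPadicPoint p P) →
        ∀ (q : ℚ), shaAn W = (q : ℂ) →
        PowerSeries.coeff 1 L ≠ 0 ∧
          ((PowerSeries.coeff 1 L : ℤ_[p]) : ℚ_[p]).valuation =
            2 * (n : ℤ) + padicValRat p (q * W.tamagawaProduct / (W.torsionOrder : ℚ) ^ 2))
    (h74l : ∀ (W : WeierstrassCurve ℚ) [W.IsElliptic] [W.IsGloballyMinimal],
      HasSignedLocalType W p (.Istar 0) → W.analyticRank = 1 →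
      ∀ (V : WeierstrassCurve ℚ) [V.IsElliptic] [V.IsGloballyMinimal] (C : VariableChange ℚ)
        {N : ℕ} [NeZero N] {f : CuspForm (Gamma0 N) 2},
        p ≠ 2 → C • W.quadraticTwist ((-1) ^ (p / 2) * p) = V →
        V.HasGoodReductionAtPrime p → V.frobeniusTrace p = 0 →
        QuadraticBranchPlusMainConjectureAt V p → IsNewformOf V f →
        ∀ (ϖ : ℚ), (if Even (p / 2) then (ϖ : ℝ) * V.realPeriodRat = plusPeriod f
            else (ϖ : ℝ) * V.imaginaryPeriodRat = minusPeriod f) →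
        ∀ (Lη : IwasawaAlgebra p), IsQuadraticBranchMinusLFunction f p ϖ Lη →
        ∀ (κ : ZpExtension ℚ p) (γ : Field.absoluteGaloisGroup ℚ),
          κ.IsCyclotomic → κ.IsTopGenerator γ → IsCyclotomicVariable p γ →
        ∀ (D : StrictSignedSelmerDualData W κ ℚ_[p] γ (-1)) (L' : IwasawaAlgebra p),
          Lη = PowerSeries.X * L' → D.charIdeal ≤ Ideal.span {L'})
    (hC1 : ∀ (V : WeierstrassCurve ℚ) [V.IsElliptic] [V.IsGloballyMinimal], V.HasCM →
      V.HasGoodReductionAtPrime p → CMInert V p → QuadraticBranchPlusMainConjectureAt V p)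
    (hcp : ∀ (W : WeierstrassCurve ℚ) [W.IsElliptic] [W.IsGloballyMinimal],
      HasSignedLocalType W p (.Istar 0) →
      padicValNat p ((W.baseChange (((primesEquiv (R := 𝓞 ℚ)).symm ⟨p, hp.out⟩).adicCompletion ℚ)).localTamagawaNumber
        (((primesEquiv (R := 𝓞 ℚ)).symm ⟨p, hp.out⟩).adicCompletionIntegers ℚ)) = 0)
    (hp2 : p ≠ 2) : LowerHalfOnType p (.Istar 0) := fun W _ _ hT hr ↦
  pairData_elim_of_ne_two W hGZK hnf hper hT hr hp2
    fun V _ _ C _ _ _ ϖ L P n hC hgood hap hCM hin hf hϖ hL htors hP hgen hdiv hndiv ↦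
      missingLowerBoundAt_of_pairValuation_of_lowerReading_of_ne_two W hmod hGZ hGZK hPT (h74l W hT hr)
        (fun q hq ↦ (hlaw W hT hr V C hC hgood hap hf ϖ hϖ L hL htors P n hP hgen hdiv hndiv q hq).2)
        hp2 (hcp W hT) hC hgood hap (hC1 V hCM hgood hin) hf hϖ hL htors hP hgen hdiv hndiv hr

/-- **THE `p = 3` CLASS NODE FOR `I₀*` AT `3` (O10-PS@3, 57 classes `N < 5·10⁵`): `LowerHalfOnType 3 I₀*`**
⟸ the law in pair form on the type at `3` ∧ (C1_η)@3 on the CM good-inert curves ∧ named facts ∧ the lower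
Kobayashi-7.4 reading at `3` ∧ `hper` at `3` — the Tamagawa hypothesis of the odd-`p` node DISCHARGED by
§0 (`3 ∤ Tam(W)` on the CM locus with `3` unramified). Cell bsd-cm D70 / N21 v1.2 (referee PASS):
the paper chain (GZ_η)@3 ⟹ C-cc-1@3 has the status of the `p ≥ 5` chain; this node is the kernel half
"print readings + C-cc-1@3 + (C1_η)@3 ⟹ the class target", exactly as at `p ≥ 5`. CONDITIONAL on every
displayed hypothesis; the `III/III*`-at-3 half of `InertBadAtThree` is untouched; nothing booked.
[cite: Kobayashi2003, §4 (p. 8), Thm. 7.4 (p. 13)] [cite: SilvermanATAEC1994, IV.9.4 and Table 4.1]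
[cite: Miller2011LMS, Def. 1.1] -/
theorem lowerHalfOnType_IstarZero_three_of_pairLaw_of_lowerReading [h3 : Fact (Nat.Prime 3)]
    (hmod : hasEntireLFunction_rat) (hGZ : GrossZagier1986_thm_I_7_3)
    (hGZK : rank_eq_analyticRank_of_analyticRank_le_one)
    (hPT : poitouTate_selmerStructure_duality_real ℚ) (hnf : exists_isNewformOf)
    (hper : ∀ (V : WeierstrassCurve ℚ) [V.IsElliptic] [V.IsGloballyMinimal]
      {N : ℕ} [NeZero N] (f : CuspForm (Gamma0 N) 2), IsNewformOf V f →
      V.HasGoodReductionAtPrime 3 → V.frobeniusTrace 3 = 0 →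
      ∃ ϖ : ℚ, ‖(ϖ : ℚ_[3])‖ ≤ 1 ∧ (ϖ : ℝ) * V.imaginaryPeriodRat = minusPeriod f)
    (hlaw : ∀ (W : WeierstrassCurve ℚ) [W.IsElliptic] [W.IsGloballyMinimal],
      HasSignedLocalType W 3 (.Istar 0) → W.analyticRank = 1 →
      ∀ (V : WeierstrassCurve ℚ) [V.IsElliptic] [V.IsGloballyMinimal] (C : VariableChange ℚ)
        {N : ℕ} [NeZero N] {f : CuspForm (Gamma0 N) 2},
        C • W.quadraticTwist (-3) = V →
        V.HasGoodReductionAtPrime 3 → V.frobeniusTrace 3 = 0 → IsNewformOf V f →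
        ∀ (ϖ : ℚ), (ϖ : ℝ) * V.imaginaryPeriodRat = minusPeriod f →
        ∀ (L : IwasawaAlgebra 3), IsQuadraticBranchMinusLFunction f 3 ϖ L →
        (∀ Q : (W.baseChange ℚ_[3]).toAffine.Point, 3 • Q = 0 → Q = 0) →
        ∀ (P : W.toAffine.Point) (n : ℕ), ¬ IsOfFinAddOrder P →
        (∀ R : W.toAffine.Point, ∃ (k : ℤ) (T : W.toAffine.Point), IsOfFinAddOrder T ∧ R = k • P + T) →
        (∃ Q : (W.baseChange ℚ_[3]).toAffine.Point, 3 ^ n • Q = W.toPadicPoint 3 P) →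
        (∀ Q : (W.baseChange ℚ_[3]).toAffine.Point, 3 ^ (n + 1) • Q ≠ W.toPadicPoint 3 P) →
        ∀ (q : ℚ), shaAn W = (q : ℂ) →
        PowerSeries.coeff 1 L ≠ 0 ∧
          ((PowerSeries.coeff 1 L : ℤ_[3]) : ℚ_[3]).valuation =
            2 * (n : ℤ) + padicValRat 3 (q * W.tamagawaProduct / (W.torsionOrder : ℚ) ^ 2))
    (h74l : ∀ (W : WeierstrassCurve ℚ) [W.IsElliptic] [W.IsGloballyMinimal],
      HasSignedLocalType W 3 (.Istar 0) → W.analyticRank = 1 →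
      ∀ (V : WeierstrassCurve ℚ) [V.IsElliptic] [V.IsGloballyMinimal] (C : VariableChange ℚ)
        {N : ℕ} [NeZero N] {f : CuspForm (Gamma0 N) 2},
        (3 : ℕ) ≠ 2 → C • W.quadraticTwist (-3) = V →
        V.HasGoodReductionAtPrime 3 → V.frobeniusTrace 3 = 0 →
        QuadraticBranchPlusMainConjectureAt V 3 → IsNewformOf V f →
        ∀ (ϖ : ℚ), (ϖ : ℝ) * V.imaginaryPeriodRat = minusPeriod f →
        ∀ (Lη : IwasawaAlgebra 3), IsQuadraticBranchMinusLFunction f 3 ϖ Lη →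
        ∀ (κ : ZpExtension ℚ 3) (γ : Field.absoluteGaloisGroup ℚ),
          κ.IsCyclotomic → κ.IsTopGenerator γ → IsCyclotomicVariable 3 γ →
        ∀ (D : StrictSignedSelmerDualData W κ ℚ_[3] γ (-1)) (L' : IwasawaAlgebra 3),
          Lη = PowerSeries.X * L' → D.charIdeal ≤ Ideal.span {L'})
    (hC1 : ∀ (V : WeierstrassCurve ℚ) [V.IsElliptic] [V.IsGloballyMinimal], V.HasCM →
      V.HasGoodReductionAtPrime 3 → CMInert V 3 → QuadraticBranchPlusMainConjectureAt V 3) :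
    LowerHalfOnType 3 (.Istar 0) := by
  -- `p* = (−1)^{3/2}·3 = −3`, `Even (3/2)` is false: the displayed data read as in the hypotheses
  have h32 : ((-1 : ℚ) ^ (3 / 2) * (3 : ℕ)) = -3 := by norm_num
  have hodd : ¬ Even (3 / 2) := by decide
  refine lowerHalfOnType_IstarZero_of_pairLaw_of_lowerReading_of_ne_two (p := 3) hmod hGZ hGZK hPT hnf
    ?_ ?_ ?_ hC1 (fun W _ _ hT ↦ ?_) (by decide)
  · intro V _ _ N _ f hf hgood hap
    obtain ⟨ϖ, hϖ, hrel⟩ := hper V f hf hgood hap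
    exact ⟨ϖ, hϖ, by rw [if_neg hodd]; exact hrel⟩
  · intro W _ _ hT hr V _ _ C N _ f hC hgood hap hf ϖ hϖ L hL htors P n hP hgen hdiv hndiv q hq
    rw [h32] at hC
    rw [if_neg hodd] at hϖ
    exact hlaw W hT hr V C hC hgood hap hf ϖ hϖ L hL htors P n hP hgen hdiv hndiv q hq
  · intro W _ _ hT hr V _ _ C N _ f h2 hC hgood hap h1 hf ϖ hϖ Lη hLη κ γ hκ hγ hγc D L' hLL'
    rw [h32] at hC
    rw [if_neg hodd] at hϖ
    exact h74l W hT hr V C h2 hC hgood hap h1 hf ϖ hϖ Lη hLη κ γ hκ hγ hγc D L' hLL'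
  · exact padicValNat_localTamagawaNumber_eq_zero_of_hasCM_three W hT.1
      (not_cmRamified_of_hasSignedLocalType W 3 hT)


end Summit.BirchSwinnertonDyer.BirchSwinnertonDyer.Theorems.InertBadOdd

end
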